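import Literature.AlgebraicGeometry.Frobenioids.RealificationDataCanonical
import Literature.AlgebraicGeometry.Frobenioids.RealificationModelRow
import Literature.AlgebraicGeometry.Frobenioids.RealificationRPow
import Literature.AnabelianGeometry.EtaleTheta.RealificationFunctor

/-!
# [EtTh] Definition 3.6 (i): the realified data CONSTRUCTED from the data of Definition 3.3 (iii)
# — the constructor `RealifiedDivisorMonoids.ofRlfZ` (monoid type `ℤ`)

Mochizuki, *The étale theta function …*, Publ. RIMS **45** (2009), Def. 3.6 (i), PDF p.76 (printed 302)
[cite: MochizukiEtTh2009, Def 3.6 p.76]: "In the notation of Definition 3.3 [(iii): the data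
`(Φ₀, B₀, B₀ → Φ₀^gp, F₀ ⊆ B₀)`, with `Φ₀^birat`, `Φ₀^cnst ⊆ Φ₀^gp`], write `Φ₀^ℝ := Φ₀^rlf` — where
`Φ₀^rlf` is as in [FrdI], Definition 2.4, (i) [cf. Proposition 3.4, (i)] …; `ℝ·Φ₀^cnst ⊆ (Φ₀^ℝ)^gp`
for the `ℝ`-vector subspace generated by `Φ₀^cnst`; `B₀^Λ` for `B₀` (resp. `B₀^pf`; `ℝ·Φ₀^birat`) if
`Λ = ℤ` (resp. `ℚ`; `ℝ`), `F₀^Λ ⊆ B₀^Λ` for `F₀` (resp. `F₀^pf`; `ℝ·Φ₀^cnst`)"; and Def. 3.6 (iii), p.77: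
elements of `Φ₀^ℝ` "arising from" non-cuspidal (resp. cuspidal) log-divisors.

abc-iut cell, layer L2, ROW `EtTh:Def3.6(i) ofRlf` (seat abc-iut-L6-t12; L2-lead 2026-08-25T23:05:44Z;
L1-lead ruling (H) 20:53Z "additive constructor `RealifiedDivisorMonoids.ofRlf`").  abc-iut-L2-t3 typed
Def. 3.6 (i) as the hypothesis structure `RealifiedDivisorMonoids V` (`TemperedFrobenioid.lean`); abc-iut-
L2-d2 constructed its realification block (`RealificationFunctor.lean`: `rlfFunctor`, `toRlfNatTrans`,
`isRealificationVia_toRealification`, and the rigidity theorem `nonempty_iso_rlfFunctor`); abc-iut-L1-d2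
supplied the `ℝ`-vector-space structure of `(Φ₀(Y)^rlf)^gp` (`RealificationData.canonical`,
`realSMul`) and abc-iut-L1-t5 the `ℝ`-span `RealificationData.realSpan` of a subfunctor of groups.
THIS FILE assembles them into the Def. 3.6 (i) data for the monoid type `Λ = ℤ` — the case the
bi-Kummer theory of §4–§5 uses ("a tempered Frobenioid whose monoid type is `ℤ`", §4 p.86):
`Φ₀^ℝ := Φ₀^rlf`, `B₀^ℤ := B₀`, `F₀^ℤ := F₀`, `B₀^ℤ → (Φ₀^ℝ)^gp := (Φ₀^gp → (Φ₀^ℝ)^gp) ∘ (B₀ → Φ₀^gp)`,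
`ℝ·Φ₀^cnst :=` the `ℝ`-span of (the subfunctor of groups generated by) `Φ₀^cnst` — now GENUINELY the
printed `ℝ`-vector subspace, so that abc-iut-L2-t3's v2 axioms `cnstR_root` ("root-closed") and
`cnst_le_cnstR` are THEOREMS — and the non-cuspidal / cuspidal parts of `Φ₀^ℝ(Y)` in the SUPPORT reading of
Def. 3.6 (iii) / Def. 3.1 (i) ("arises from a non-cuspidal (resp. cuspidal) log-divisor" = supported in
the primes of the special fibre (resp. of the divisor of cusps)): the elements of `Φ₀(Y)^rlf ⊆ ∏_𝔭
Φ₀(Y)^rlf_𝔭` whose support lies in the union of the supports of the images `ι(a)` of the non-cuspidal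
(resp. cuspidal) `a ∈ Φ₀(Y)` (audit note N-a of abc-iut-L2-d2, 2026-08-25T23:26Z: the smaller
"submonoid generated by the real powers `ι(a)^r`" would miss infinitely supported elements, e.g. over
`Ÿ`).  The only hypothesis is Prop. 3.4 (i): "`Φ₀(Y^log)` is perf-factorial" for every `Y`.
(The types `ℚ`, `ℝ` — `B₀^pf`, `ℝ·Φ₀^birat` — are left for a sequel; nothing here asserts the data exist
for an actual curve.)
-/

noncomputable section

namespace Literature.AnabelianGeometry.EtaleTheta

open CategoryTheory Opposite Literature.AlgebraicGeometry.Frobenioids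

universe u v w

/-! ### `gpMap` (the §3 files) is `MonGp.map` (the [FrdI] files) -/

/-- The two names for the groupification of a homomorphism agree (same definition).
[cite: MochizukiEtTh2009, Def 3.3 p.73] -/
theorem gpMap_eq_monGpMap {M N : Type w} [CommMonoid M] [CommMonoid N] (f : M →* N) :
    gpMap f = MonGp.map f := rfl

/-- `gpMap` is functorial: `gpMap (g ∘ f) = gpMap g ∘ gpMap f` on elements.
[cite: MochizukiEtTh2009, Def 3.3 p.73] -/
theorem gpMap_comp_apply'' {M N P : Type w} [CommMonoid M] [CommMonoid N] [CommMonoid P] (f : M →* N)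
    (g : N →* P) (x : Algebra.GrothendieckGroup M) : gpMap (g.comp f) x = gpMap g (gpMap f x) := by
  rw [gpMap_eq_monGpMap, gpMap_eq_monGpMap, gpMap_eq_monGpMap, MonGp.map_comp]
  rfl

namespace DivisorMonoids

variable {D₀ : Type u} [Category.{v} D₀] (T : DivisorMonoids.{u, v, w} D₀)

/-- **`Φ₀^cnst` as a subfunctor of groups of `Φ₀^gp`**: objectwise the subgroup of `Φ₀(Y)^gp` generated
by "the image of `F₀` in `Φ₀^gp`" (Def. 3.3 (iii), p.73; `F₀` is a group of [constant] functions, so in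
print `Φ₀^cnst` is already a group), stable under pull-back by the naturality of `B₀ → Φ₀^gp` and the
subfunctor property of `F₀`. [cite: MochizukiEtTh2009, Def 3.3 p.73] -/
def cnstGp : GpSubfunctor T.Φ₀ where
  carrier X := Subgroup.closure (T.cnst (op X) : Set (Algebra.GrothendieckGroup (T.Φ₀.obj (op X))))
  pull_mem := by
    intro X Y f c hc
    have hle : (Subgroup.closure (T.cnst (op Y) : Set _)).map (pullGp T.Φ₀ f) ≤
        Subgroup.closure (T.cnst (op X) : Set _) := by
      rw [MonoidHom.map_closure]
      apply Subgroup.closure_mono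
      rintro _ ⟨x, ⟨b, hb, rfl⟩, rfl⟩
      refine ⟨(T.B₀.map f.op).hom b, T.F₀_map f.op b hb, ?_⟩
      change T.div₀ (op X) ((T.B₀.map f.op).hom b) = MonGp.map (T.Φ₀.map f.op).hom (T.div₀ (op Y) b)
      rw [T.div₀_natural f.op b, gpMap_eq_monGpMap]
    exact hle (Subgroup.mem_map_of_mem _ hc)

/-- `Φ₀^cnst(Y)` lies in the subgroup it generates. [cite: MochizukiEtTh2009, Def 3.3 p.73] -/
theorem mem_cnstGp_of_mem_cnst (X : D₀) {c : Algebra.GrothendieckGroup (T.Φ₀.obj (op X))}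
    (hc : c ∈ T.cnst (op X)) : c ∈ T.cnstGp.carrier X :=
  Subgroup.subset_closure hc

end DivisorMonoids

/-! ### `ℝ`-spans in `(Φ^rlf)^gp` are `ℝ`-subspaces: stability under the action, root-closedness -/

namespace RealificationDataLemmas

variable {D : Type u} [Category.{v} D] {Φ : Dᵒᵖ ⥤ CommMonCat.{w}} (R : RealificationData Φ)
  (Ψ : GpSubfunctor Φ)

/-- `ℝ · Ψ(X)` is stable under the `ℝ`-action: `s • (ℝ·Ψ) ⊆ ℝ·Ψ` (the generators `r • ι(c)` go to the
generators `(s r) • ι(c)`). [cite: MochizukiFrdI2008, Prop. 5.3 p.103] -/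
theorem rsmul_mem_realSpan (X : D) (s : ℝ) {x : Algebra.GrothendieckGroup (R.rlf.obj (op X))}
    (hx : x ∈ (R.realSpan Ψ).carrier X) : R.rsmul X s x ∈ (R.realSpan Ψ).carrier X := by
  have hle : (Subgroup.closure (R.realSpanGen Ψ X)).map (R.rsmul X s) ≤
      Subgroup.closure (R.realSpanGen Ψ X) := by
    rw [MonoidHom.map_closure]
    apply Subgroup.closure_mono
    rintro _ ⟨y, ⟨r, c, hc, rfl⟩, rfl⟩
    exact ⟨s * r, c, hc, by rw [R.rsmul_mul]⟩
  exact hle (Subgroup.mem_map_of_mem _ hx)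

/-- `ℝ · Ψ(X)` is ROOT-CLOSED in `(Φ^rlf)^gp(X)`: `g^n ∈ ℝ·Ψ`, `n ≥ 1` ⇒ `g = (1/n) • g^n ∈ ℝ·Ψ` (the
printed "`ℝ`-vector subspace"; this is abc-iut-L2-t3's axiom `cnstR_root`). [cite: MochizukiEtTh2009, Def 3.6 p.76] -/
theorem mem_realSpan_of_pow_mem (X : D) {g : Algebra.GrothendieckGroup (R.rlf.obj (op X))} {n : ℕ}
    (hn : 0 < n) (hg : g ^ n ∈ (R.realSpan Ψ).carrier X) : g ∈ (R.realSpan Ψ).carrier X := by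
  have h := rsmul_mem_realSpan R Ψ X ((n : ℝ)⁻¹) hg
  rwa [R.rsmul_inv_natCast_pow X hn] at h

end RealificationDataLemmas

/-! ### The constructor -/

namespace RealifiedDivisorMonoids

variable {D₀ : Type u} [Category.{v} D₀] (dm : DivisorMonoids.{u, v, w} D₀)
  (hpf : ∀ Y : D₀ᵒᵖ, IsPerfFactorial (dm.Φ₀.obj Y))

/-- THE realification data of `Φ₀` ([FrdI] Prop. 5.3 for the monoid `Φ₀`; abc-iut-L1-d2's
`RealificationData.canonical`: `Φ₀^rlf`, `Φ₀^pf → Φ₀^rlf`, `ℝ ↷ (Φ₀^rlf)^gp`).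
[cite: MochizukiEtTh2009, Def 3.6 p.76] -/
abbrev realData : RealificationData dm.Φ₀ := RealificationData.canonical dm.Φ₀ hpf

/-- The groupified natural map of THE realification data is `gpMap` of `Φ₀(Y) → Φ₀(Y)^rlf`.
[cite: MochizukiEtTh2009, Def 3.6 p.76] -/
theorem toRlfGp_realData_eq (X : D₀) :
    (realData dm hpf).toRlfGp X = gpMap ((toRlfNatTrans dm.Φ₀ hpf).app (op X)).hom := by
  apply MonGp.hom_ext
  intro a
  rw [RealificationData.toRlfGp, MonGp.map_of, RealificationData.canonical_toRlf_app_hom]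
  exact (gpMap_of ((toRlfNatTrans dm.Φ₀ hpf).app (op X)).hom a).symm

/-- The submonoid of `M^rlf` of the elements SUPPORTED in a given set `S` of primes (support taken in
`M^rlf ⊆ M^rlf_factor = ∏_𝔭 M^rlf_𝔭`, [FrdI] Def. 2.4 (i)(c)); closed under products since
`supp(ab) ⊆ supp(a) ∪ supp(b)`. [cite: MochizukiFrdI2008, Def. 2.4 (i) p.48] -/
def rlfSuppIn {M : Type w} [CommMonoid M] (h : IsPerfFactorial M) (S : Set (Primes (Perfection M))) :
    Submonoid h.Rlf where
  carrier := {x | supp (x : RlfFactor M) ⊆ S}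
  mul_mem' {x y} hx hy := (supp_mul_subset (x : RlfFactor M) (y : RlfFactor M)).trans (Set.union_subset hx hy)
  one_mem' := fun _ h𝔮 => (h𝔮 rfl).elim

/-- Membership in `rlfSuppIn`. [cite: MochizukiFrdI2008, Def. 2.4 (i) p.48] -/
theorem mem_rlfSuppIn_iff {M : Type w} [CommMonoid M] (h : IsPerfFactorial M)
    (S : Set (Primes (Perfection M))) (x : h.Rlf) : x ∈ rlfSuppIn h S ↔ supp (x : RlfFactor M) ⊆ S :=
  Iff.rfl

/-- The set of primes of `Φ₀(Y)` "arising from" a given set `N ⊆ Φ₀(Y)` of log-divisors: the union of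
the supports, in `Φ₀(Y)^rlf`, of the images `ι(a)`, `a ∈ N` (for `N =` the non-cuspidal, resp.
cuspidal, elements: the primes lying in the special fibre, resp. in the divisor of cusps, Def. 3.1 (i)
p.70). [cite: MochizukiEtTh2009, Def 3.6 p.77] -/
def toRSuppOf (Y : D₀ᵒᵖ) (N : Submonoid (dm.Φ₀.obj Y)) : Set (Primes (Perfection (dm.Φ₀.obj Y))) :=
  ⋃ a ∈ (N : Set (dm.Φ₀.obj Y)),
    supp ((hpf Y).realification.subtype (((toRlfNatTrans dm.Φ₀ hpf).app Y).hom a))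

/-- The image `ι(a)` of `a ∈ N` is supported in the primes arising from `N`.
[cite: MochizukiEtTh2009, Def 3.6 p.77] -/
theorem supp_toR_subset_toRSuppOf (Y : D₀ᵒᵖ) {N : Submonoid (dm.Φ₀.obj Y)} {a : dm.Φ₀.obj Y}
    (ha : a ∈ N) :
    supp ((hpf Y).realification.subtype (((toRlfNatTrans dm.Φ₀ hpf).app Y).hom a)) ⊆
      toRSuppOf dm hpf Y N :=
  Set.subset_biUnion_of_mem
    (u := fun a : dm.Φ₀.obj Y =>
      supp ((hpf Y).realification.subtype (((toRlfNatTrans dm.Φ₀ hpf).app Y).hom a))) ha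

/-- **Definition 3.6 (i) for the monoid type `Λ = ℤ`, CONSTRUCTED** from the Def. 3.3 (iii) data `dm` and
Prop. 3.4 (i) ("`Φ₀(Y)` perf-factorial"): `Φ₀^ℝ := Φ₀^rlf` (the realification functor), `B₀^ℤ := B₀`,
`F₀^ℤ := F₀`, `B₀^ℤ → (Φ₀^ℝ)^gp := ι ∘ (B₀ → Φ₀^gp)`, `ℝ·Φ₀^cnst :=` the `ℝ`-span of `Φ₀^cnst` in
`(Φ₀^ℝ)^gp`, and the non-cuspidal / cuspidal parts of `Φ₀^ℝ(Y)` (Def. 3.6 (iii), p.77) := the elements of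
`Φ₀(Y)^rlf` supported in the primes arising from the non-cuspidal / cuspidal elements of `Φ₀(Y)`
(support reading of "arises from a non-cuspidal (resp. cuspidal) log-divisor", Def. 3.1 (i)).  All of abc-iut-L2-t3's Def. 3.6 (i) axioms (naturality of `Φ₀ → Φ₀^ℝ` and of
`B₀^Λ → (Φ₀^ℝ)^gp`, realification via the tree's vocabulary, `B₀^Λ` group-like, `F₀^Λ ↦ ℝ·Φ₀^cnst`,
pull-back stability and root-closedness of `ℝ·Φ₀^cnst`, `Φ₀^cnst ⊆ ℝ·Φ₀^cnst`, compatibility with the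
(non-)cuspidal parts) are PROVED. [cite: MochizukiEtTh2009, Def 3.6 p.76] -/
def ofRlfZ : RealifiedDivisorMonoids (D₀ := D₀) treeMonoidVocab.{w} where
  toDivisorMonoids := dm
  Λ := MonoidType.Z
  ΦR := rlfFunctor dm.Φ₀ hpf
  toR Y := ((toRlfNatTrans dm.Φ₀ hpf).app Y).hom
  toR_natural f x := (rlfMap_toRealification_of dm.Φ₀ hpf f x).symm
  isRealification Y := isRealificationVia_toRealification (hpf Y)
  BΛ := dm.B₀
  isUnit_BΛ := dm.isUnit_B₀
  divΛ Y := (gpMap ((toRlfNatTrans dm.Φ₀ hpf).app Y).hom).comp (dm.div₀ Y)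
  divΛ_natural {Y Y'} f b := by
    have hcomp : ((toRlfNatTrans dm.Φ₀ hpf).app Y').hom.comp (dm.Φ₀.map f).hom =
        ((rlfFunctor dm.Φ₀ hpf).map f).hom.comp ((toRlfNatTrans dm.Φ₀ hpf).app Y).hom :=
      MonoidHom.ext fun x => (rlfMap_toRealification_of dm.Φ₀ hpf f x).symm
    change gpMap ((toRlfNatTrans dm.Φ₀ hpf).app Y').hom (dm.div₀ Y' ((dm.B₀.map f).hom b)) =
      gpMap ((rlfFunctor dm.Φ₀ hpf).map f).hom (gpMap ((toRlfNatTrans dm.Φ₀ hpf).app Y).hom (dm.div₀ Y b))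
    rw [dm.div₀_natural f b, ← gpMap_comp_apply'', ← gpMap_comp_apply'', hcomp]
  FΛ := dm.F₀
  FΛ_map := dm.F₀_map
  cnstR Y := ((realData dm hpf).realSpan dm.cnstGp).carrier (unop Y)
  cnstR_map {Y Y'} f x hx := by
    have h := ((realData dm hpf).realSpan dm.cnstGp).pull_mem f.unop hx
    rwa [pullGp, ← gpMap_eq_monGpMap] at h
  divΛ_mem_cnstR Y b hb := by
    change gpMap ((toRlfNatTrans dm.Φ₀ hpf).app Y).hom (dm.div₀ Y b) ∈
      ((realData dm hpf).realSpan dm.cnstGp).carrier (unop Y)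
    rw [← toRlfGp_realData_eq]
    exact (realData dm hpf).toRlfGp_mem_realSpan dm.cnstGp (unop Y)
      (dm.mem_cnstGp_of_mem_cnst (unop Y) ⟨b, hb, rfl⟩)
  cnstR_root Y g n hg := RealificationDataLemmas.mem_realSpan_of_pow_mem _ _ (unop Y) n.pos hg
  cnst_le_cnstR Y b hb := by
    change gpMap ((toRlfNatTrans dm.Φ₀ hpf).app Y).hom (dm.div₀ Y b) ∈
      ((realData dm hpf).realSpan dm.cnstGp).carrier (unop Y)
    rw [← toRlfGp_realData_eq]
    exact (realData dm hpf).toRlfGp_mem_realSpan dm.cnstGp (unop Y)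
      (dm.mem_cnstGp_of_mem_cnst (unop Y) ⟨b, hb, rfl⟩)
  ncspR Y := rlfSuppIn (hpf Y) (toRSuppOf dm hpf Y (dm.ncsp₀ Y))
  cspR Y := rlfSuppIn (hpf Y) (toRSuppOf dm hpf Y (dm.csp₀ Y))
  toR_ncsp Y x hx := supp_toR_subset_toRSuppOf dm hpf Y hx
  toR_csp Y x hx := supp_toR_subset_toRSuppOf dm hpf Y hx

/-! ### What the constructor returns (definitional unfoldings for consumers) -/

/-- `ofRlfZ` keeps the Def. 3.3 (iii) data. [cite: MochizukiEtTh2009, Def 3.6 p.76] -/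
@[simp] theorem ofRlfZ_toDivisorMonoids : (ofRlfZ dm hpf).toDivisorMonoids = dm := rfl

/-- The monoid type of `ofRlfZ` is `ℤ`. [cite: MochizukiEtTh2009, Def 3.6 p.76] -/
@[simp] theorem ofRlfZ_Λ : (ofRlfZ dm hpf).Λ = MonoidType.Z := rfl

/-- `Φ₀^ℝ` of `ofRlfZ` is the realification functor `Φ₀^rlf`. [cite: MochizukiEtTh2009, Def 3.6 p.76] -/
@[simp] theorem ofRlfZ_ΦR : (ofRlfZ dm hpf).ΦR = rlfFunctor dm.Φ₀ hpf := rfl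

/-- `Φ₀ → Φ₀^ℝ` of `ofRlfZ` is the natural map `Φ₀ → Φ₀^pf → Φ₀^rlf`. [cite: MochizukiEtTh2009, Def 3.6 p.76] -/
theorem ofRlfZ_toR (Y : D₀ᵒᵖ) : (ofRlfZ dm hpf).toR Y = ((toRlfNatTrans dm.Φ₀ hpf).app Y).hom := rfl

/-- `B₀^ℤ := B₀`. [cite: MochizukiEtTh2009, Def 3.6 p.76] -/
@[simp] theorem ofRlfZ_BΛ : (ofRlfZ dm hpf).BΛ = dm.B₀ := rfl

/-- `F₀^ℤ := F₀`. [cite: MochizukiEtTh2009, Def 3.6 p.76] -/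
@[simp] theorem ofRlfZ_FΛ (Y : D₀ᵒᵖ) : (ofRlfZ dm hpf).FΛ Y = dm.F₀ Y := rfl

/-- `ℝ·Φ₀^cnst` of `ofRlfZ` is the `ℝ`-span of `Φ₀^cnst` in `(Φ₀^rlf)^gp` (THE realification data).
[cite: MochizukiEtTh2009, Def 3.6 p.76] -/
theorem ofRlfZ_cnstR (Y : D₀ᵒᵖ) :
    (ofRlfZ dm hpf).cnstR Y = ((realData dm hpf).realSpan dm.cnstGp).carrier (unop Y) := rfl

/-- `ℝ·Φ₀^cnst` of `ofRlfZ` is an `ℝ`-subspace: stable under the `ℝ`-action of `(Φ₀^rlf)^gp` (the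
property abc-iut-L2-t3's interface records only through its consequence `cnstR_root`).
[cite: MochizukiEtTh2009, Def 3.6 p.76] -/
theorem ofRlfZ_rsmul_mem_cnstR (Y : D₀ᵒᵖ) (s : ℝ)
    {x : Algebra.GrothendieckGroup ((rlfFunctor dm.Φ₀ hpf).obj Y)} (hx : x ∈ (ofRlfZ dm hpf).cnstR Y) :
    (realData dm hpf).rsmul (unop Y) s x ∈ (ofRlfZ dm hpf).cnstR Y :=
  RealificationDataLemmas.rsmul_mem_realSpan _ _ (unop Y) s hx

end RealifiedDivisorMonoids

end Literature.AnabelianGeometry.EtaleTheta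

end
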